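import Literature.Combinatorics.SimpleGraph.HamiltonianRailGadget
import HarnessLib

/-!
# Gadget substitution for Hamiltonian-path counts, VII: the rail gadgets used (XOR, OR₁, OR₂, OR₃)

The instances of the generic rail-gadget theory (`HamiltonianRailGadget.lean`) used by the
`#SAT → #HamPath` construction, certified here by `decide` through `exclusive_of_exclCheckB`,
`coverSet_eq_singleton`, `coverSet_eq_empty`, `coverSet_empty_slots`. The two OR-gadgets were found
by exhaustive computer search over rung matchings drawable without crossings (rails side by side
along the slots, cross rungs as nested chords above them, one same-rail rung under each rail).

* `RailXOR.Γ` — **the subdivided ladder as a rail gadget** (2 rails of 4 nodes, rungs `(0,i)–(1,i)`;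
  the template of `HamiltonianGadgetLadder.lean` again): census `1` on the two singletons, `0` on `∅`
  and on both slots (`RailXOR.coverCount_eq`) — "exactly one of the two slot edges is used".
* `RailOR1.Γ` — **one-input OR** (a slot edge subdivided, with a chord): 1 rail of 2 nodes, one rung;
  census `1` on its slot, `0` on `∅` — "the slot edge must be used" (unit clauses).

* `RailOR3.Γ` — **three-input OR**: rails `A, B, C` of six nodes, rungs
  `A1–A5, B1–B5, C1–C5` (under the rails) and `A0–C4, A2–C3, A3–B2, A4–B0, B3–C2, B4–C0` (above).
  It is exclusive and its census is `N(U) = 1` for EVERY nonempty set `U` of slots and `N(∅) = 0`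
  (`RailOR3.coverCount_eq`): substituted for three slot edges it keeps exactly the Hamiltonian paths
  using at least one of them, each with multiplicity one — a clause gadget with uniform census (the
  OR-gadget of Liśkiewicz–Ogihara–Toda 2003, §3, has census 2/4 and needs the not-all-equal normal
  form; this one does not).
* `RailOR2.Γ` — **two-input OR**: rails `A, B` of six nodes, rungs `A1–A5, B1–B5` and
  `A0–B4, A2–B3, A3–B2, A4–B0`; census `1` on `{A}, {B}, {A,B}`, `0` on `∅` (`RailOR2.coverCount_eq`).

Planarity of the drawings described above is used only later (grid drawings) and is not formalised
in this file.

## References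

* M. R. Garey, D. S. Johnson, R. E. Tarjan, SIAM J. Comput. 5 (1976) 704–714, §2.
* M. Liśkiewicz, M. Ogihara, S. Toda, TCS 304 (2003) 129–156, §3 (OR-gadget, Fig. 3).
-/

namespace Literature.Combinatorics.SimpleGraph

open RailV RailGadget

/-! ### Shared packaging -/

namespace RailGadget

variable {k K m : ℕ} (Γ : RailGadget k K m)

/-- From the exclusivity check over all bit vectors to the census of a nonempty set of rails.
[folklore] -/
theorem coverSet_eq_of_checks (hcov : ∀ n < 2 ^ k, 0 < n → Γ.coverCheckB (bitsU k n) = true)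
    (U₀ : Finset (Fin k)) (hU₀ : U₀.Nonempty) :
    coverSet Γ.graph Γ.VX (U₀.image Γ.slot) = {Γ.coverFun (indB U₀)} := by
  apply Γ.coverSet_eq_singleton
  obtain ⟨n, hn, hU⟩ := exists_bitsU (indB U₀)
  rw [← hU]
  refine hcov n hn (Nat.pos_of_ne_zero ?_)
  rintro rfl
  obtain ⟨r, hr⟩ := hU₀
  have := congrFun hU r
  simp [bitsU, indB, hr] at this

/-- **The census of a rail gadget all of whose nonempty entered sets pass the cover check**: `1` on
every nonempty set of slots, `0` on `∅`. [folklore] -/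
theorem coverCount_eq_of_checks (hk : 0 < k) (hcov : ∀ n < 2 ^ k, 0 < n → Γ.coverCheckB (bitsU k n) = true)
    (U : Finset (RailV k K m × RailV k K m)) (hU : U ⊆ Γ.slots) :
    coverCount Γ.graph Γ.VX U = if U = ∅ then 0 else 1 := by
  obtain ⟨U₀, rfl⟩ := Γ.exists_eq_image_of_subset hU
  by_cases h0 : U₀ = ∅
  · subst h0
    rw [Finset.image_empty, if_pos rfl, coverCount, Γ.coverSet_empty_slots hk, Set.ncard_empty]
  · rw [if_neg (by simpa [Finset.image_eq_empty] using h0), coverCount,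
      Γ.coverSet_eq_of_checks hcov U₀ (Finset.nonempty_iff_ne_empty.2 h0), Set.ncard_singleton]

end RailGadget

/-! ### The XOR-gadget (subdivided ladder) -/

namespace RailXOR

/-- Rung `ρ` joins `(0, ρ)` and `(1, ρ)`. [folklore] -/
def fst (ρ : Fin 4) : Fin 2 × Fin 4 := (0, ρ)

/-- Rung `ρ` joins `(0, ρ)` and `(1, ρ)`. [folklore] -/
def snd (ρ : Fin 4) : Fin 2 × Fin 4 := (1, ρ)

/-- The rung through `(r, i)` is rung `i`. [folklore] -/
def rungOf (x : Fin 2 × Fin 4) : Fin 4 := x.2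

/-- **The XOR-gadget** (subdivided ladder) as a rail gadget: 2 rails of 4 nodes, 4 rungs. [folklore] -/
def Γ : RailGadget 2 4 4 where
  fst := fst
  snd := snd
  rungOf := rungOf
  fst_ne_snd := by decide
  rungOf_spec := by decide
  rungOf_fst := by decide
  rungOf_snd := by decide
  two_le := by decide
  even := ⟨2, rfl⟩

set_option maxRecDepth 8000 in
/-- The exclusivity check passes for all four entered sets. [folklore] -/
theorem excl_check : ∀ n < 2 ^ 2, Γ.exclCheckB (bitsU 2 n) = true := by
  decide

/-- **The XOR-gadget is exclusive.** [folklore] -/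
theorem exclusive : Exclusive Γ.graph Γ.VX Γ.slots :=
  Γ.exclusive_of_exclCheckB excl_check

set_option maxRecDepth 8000 in
/-- The cover check passes for the two singletons. [folklore] -/
theorem cover_check_one : Γ.coverCheckB (indB {0}) = true ∧ Γ.coverCheckB (indB {1}) = true := by
  constructor <;> decide

set_option maxRecDepth 8000 in
/-- The no-cover check passes for both slots together. [folklore] -/
theorem empty_check_two : Γ.emptyCheckB (indB {0, 1}) = true := by
  decide

/-- **Census of the XOR-gadget**: `1` on each single slot, `0` on `∅` and on both slots — substituted
for two slot edges it keeps exactly the Hamiltonian paths using exactly one of them. [folklore] -/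
theorem coverCount_eq (U : Finset (RailV 2 4 4 × RailV 2 4 4)) (hU : U ⊆ Γ.slots) :
    coverCount Γ.graph Γ.VX U = if U.card = 1 then 1 else 0 := by
  obtain ⟨U₀, rfl⟩ := Γ.exists_eq_image_of_subset hU
  rw [Finset.card_image_of_injective _ Γ.slot_injective]
  -- the four subsets of `{0, 1}`
  have hcases : U₀ = ∅ ∨ U₀ = {0} ∨ U₀ = {1} ∨ U₀ = {0, 1} := by
    have : ∀ r : Fin 2, r = 0 ∨ r = 1 := by decide
    by_cases h0 : (0 : Fin 2) ∈ U₀ <;> by_cases h1 : (1 : Fin 2) ∈ U₀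
    · refine Or.inr (Or.inr (Or.inr ?_)); ext r; rcases this r with rfl | rfl <;> simp [h0, h1]
    · refine Or.inr (Or.inl ?_); ext r; rcases this r with rfl | rfl <;> simp [h0, h1]
    · refine Or.inr (Or.inr (Or.inl ?_)); ext r; rcases this r with rfl | rfl <;> simp [h0, h1]
    · refine Or.inl ?_; ext r; rcases this r with rfl | rfl <;> simp [h0, h1]
  rcases hcases with rfl | rfl | rfl | rfl
  · rw [Finset.image_empty, coverCount, Γ.coverSet_empty_slots (by decide), Set.ncard_empty]; rfl
  · rw [coverCount, Γ.coverSet_eq_singleton {0} cover_check_one.1, Set.ncard_singleton]; rfl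
  · rw [coverCount, Γ.coverSet_eq_singleton {1} cover_check_one.2, Set.ncard_singleton]; rfl
  · rw [coverCount, Γ.coverSet_eq_empty {0, 1} empty_check_two, Set.ncard_empty]; rfl

end RailXOR

/-! ### The one-input OR-gadget -/

namespace RailOR1

/-- **The one-input OR-gadget**: 1 rail of 2 nodes with one rung between them (a subdivided slot
edge with a chord). [folklore] -/
def Γ : RailGadget 1 2 1 where
  fst := fun _ => (0, 0)
  snd := fun _ => (0, 1)
  rungOf := fun _ => 0
  fst_ne_snd := by decide
  rungOf_spec := by decide
  rungOf_fst := by decide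
  rungOf_snd := by decide
  two_le := by decide
  even := ⟨1, rfl⟩

/-- The exclusivity check passes. [folklore] -/
theorem excl_check : ∀ n < 2 ^ 1, Γ.exclCheckB (bitsU 1 n) = true := by
  decide

/-- The cover check passes for the one nonempty entered set. [folklore] -/
theorem cover_check : ∀ n < 2 ^ 1, 0 < n → Γ.coverCheckB (bitsU 1 n) = true := by
  decide

/-- **The one-input OR-gadget is exclusive.** [folklore] -/
theorem exclusive : Exclusive Γ.graph Γ.VX Γ.slots :=
  Γ.exclusive_of_exclCheckB excl_check

/-- **Census of the one-input OR-gadget**: `1` on its slot, `0` on `∅` — the slot edge must be used.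
[folklore] -/
theorem coverCount_eq (U : Finset (RailV 1 2 1 × RailV 1 2 1)) (hU : U ⊆ Γ.slots) :
    coverCount Γ.graph Γ.VX U = if U = ∅ then 0 else 1 :=
  Γ.coverCount_eq_of_checks (by decide) cover_check U hU

end RailOR1

/-! ### The three-input OR-gadget -/

namespace RailOR3

/-- First ends of the nine rungs (`0:A1–A5, 1:B1–B5, 2:C1–C5, 3:A0–C4, 4:A2–C3, 5:A3–B2, 6:A4–B0,
7:B3–C2, 8:B4–C0`; rails `A,B,C = 0,1,2`). [folklore] -/
def fst (ρ : Fin 9) : Fin 3 × Fin 6 :=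
  match ρ.val with
  | 0 => (0, 1) | 1 => (1, 1) | 2 => (2, 1) | 3 => (0, 0) | 4 => (0, 2) | 5 => (0, 3) | 6 => (0, 4) | 7 => (1, 3)
  | _ => (1, 4)

/-- Second ends of the nine rungs. [folklore] -/
def snd (ρ : Fin 9) : Fin 3 × Fin 6 :=
  match ρ.val with
  | 0 => (0, 5) | 1 => (1, 5) | 2 => (2, 5) | 3 => (2, 4) | 4 => (2, 3) | 5 => (1, 2) | 6 => (1, 0) | 7 => (2, 2)
  | _ => (2, 0)

/-- The rung through each rail node. [folklore] -/
def rungOf (x : Fin 3 × Fin 6) : Fin 9 :=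
  match x.1.val, x.2.val with
  | 0, 0 => 3 | 0, 1 => 0 | 0, 2 => 4 | 0, 3 => 5 | 0, 4 => 6 | 0, 5 => 0
  | 1, 0 => 6 | 1, 1 => 1 | 1, 2 => 5 | 1, 3 => 7 | 1, 4 => 8 | 1, 5 => 1
  | 2, 0 => 8 | 2, 1 => 2 | 2, 2 => 7 | 2, 3 => 4 | 2, 4 => 3 | _, _ => 2

/-- **The three-input OR-gadget** as a rail gadget (3 rails of 6 nodes, 9 rungs). [folklore] -/
def Γ : RailGadget 3 6 9 where
  fst := fst
  snd := snd
  rungOf := rungOf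
  fst_ne_snd := by decide
  rungOf_spec := by decide
  rungOf_fst := by decide
  rungOf_snd := by decide
  two_le := by decide
  even := ⟨3, rfl⟩

set_option maxRecDepth 8000 in
/-- The exclusivity check passes for all eight entered sets. [folklore] -/
theorem excl_check : ∀ n < 2 ^ 3, Γ.exclCheckB (bitsU 3 n) = true := by
  decide

set_option maxRecDepth 8000 in
/-- The cover check passes for all seven nonempty entered sets. [folklore] -/
theorem cover_check : ∀ n < 2 ^ 3, 0 < n → Γ.coverCheckB (bitsU 3 n) = true := by
  decide

/-- **The three-input OR-gadget is exclusive.** [folklore] -/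
theorem exclusive : Exclusive Γ.graph Γ.VX Γ.slots :=
  Γ.exclusive_of_exclCheckB excl_check

/-- **Census of the three-input OR-gadget**: `1` on every nonempty set of slots, `0` on `∅`. [folklore] -/
theorem coverCount_eq (U : Finset (RailV 3 6 9 × RailV 3 6 9)) (hU : U ⊆ Γ.slots) :
    coverCount Γ.graph Γ.VX U = if U = ∅ then 0 else 1 :=
  Γ.coverCount_eq_of_checks (by decide) cover_check U hU

end RailOR3

/-! ### The two-input OR-gadget -/

namespace RailOR2

/-- First ends of the six rungs (`0:A1–A5, 1:B1–B5, 2:A0–B4, 3:A2–B3, 4:A3–B2, 5:A4–B0`). [folklore] -/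
def fst (ρ : Fin 6) : Fin 2 × Fin 6 :=
  match ρ.val with
  | 0 => (0, 1) | 1 => (1, 1) | 2 => (0, 0) | 3 => (0, 2) | 4 => (0, 3) | _ => (0, 4)

/-- Second ends of the six rungs. [folklore] -/
def snd (ρ : Fin 6) : Fin 2 × Fin 6 :=
  match ρ.val with
  | 0 => (0, 5) | 1 => (1, 5) | 2 => (1, 4) | 3 => (1, 3) | 4 => (1, 2) | _ => (1, 0)

/-- The rung through each rail node. [folklore] -/
def rungOf (x : Fin 2 × Fin 6) : Fin 6 :=
  match x.1.val, x.2.val with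
  | 0, 0 => 2 | 0, 1 => 0 | 0, 2 => 3 | 0, 3 => 4 | 0, 4 => 5 | 0, 5 => 0
  | 1, 0 => 5 | 1, 1 => 1 | 1, 2 => 4 | 1, 3 => 3 | 1, 4 => 2 | _, _ => 1

/-- **The two-input OR-gadget** as a rail gadget (2 rails of 6 nodes, 6 rungs). [folklore] -/
def Γ : RailGadget 2 6 6 where
  fst := fst
  snd := snd
  rungOf := rungOf
  fst_ne_snd := by decide
  rungOf_spec := by decide
  rungOf_fst := by decide
  rungOf_snd := by decide
  two_le := by decide
  even := ⟨3, rfl⟩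

set_option maxRecDepth 8000 in
/-- The exclusivity check passes for all four entered sets. [folklore] -/
theorem excl_check : ∀ n < 2 ^ 2, Γ.exclCheckB (bitsU 2 n) = true := by
  decide

set_option maxRecDepth 8000 in
/-- The cover check passes for all three nonempty entered sets. [folklore] -/
theorem cover_check : ∀ n < 2 ^ 2, 0 < n → Γ.coverCheckB (bitsU 2 n) = true := by
  decide

/-- **The two-input OR-gadget is exclusive.** [folklore] -/
theorem exclusive : Exclusive Γ.graph Γ.VX Γ.slots :=
  Γ.exclusive_of_exclCheckB excl_check

/-- **Census of the two-input OR-gadget**: `1` on every nonempty set of slots, `0` on `∅`. [folklore] -/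
theorem coverCount_eq (U : Finset (RailV 2 6 6 × RailV 2 6 6)) (hU : U ⊆ Γ.slots) :
    coverCount Γ.graph Γ.VX U = if U = ∅ then 0 else 1 :=
  Γ.coverCount_eq_of_checks (by decide) cover_check U hU

end RailOR2

end Literature.Combinatorics.SimpleGraph
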